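import Mathlib
import Literature.Computability.AlgebraicComplexity.PermanentCompleteness
import Literature.Computability.Complexity.Circuit
import Literature.Computability.Complexity.FormulaComposition
import Literature.Computability.Complexity.KWProtocolFormula

/-!
# Crux `ShallowShadows.ShadowFormulaTransfer` (stmt-ValiantsHypothesis-17124), line
# `Sketch-ideator1` — the registered stub `stub_shadowOfArithExpr` (Jukna's Lemma 7, formula form)

The SHADOW of a polynomial `p` is the monotone Boolean function
`B p : a ↦ [∃ m ∈ supp p, supp m ⊆ {i | a i}]`. Over the semiring `ℝ≥0` there is no cancellation:
`supp (p + q) = supp p ∪ supp q` and `supp (p · q) = supp p + supp q`, so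
`B (p + q) = B p ∨ B q` and `B (p · q) = B p ∧ B q` (`nnshadow_add_iff`, `nnshadow_mul_iff`).
Hence a monotone arithmetic formula `φ : ArithExpr ℝ≥0 ι` (BCS (21.19)) is, gate by gate
(`+ ↦ ∨₂`, `× ↦ ∧₂`, in the tree's straight-line model `Circuit ι` via `Circuit.binop`), a
formula over the monotone basis `{∧₂, ∨₂}` for the shadow of `val(φ)`, with at most `E(φ)` gates
(Jukna, *Lower bounds for monotone counting circuits*, arXiv:1406.3065, Lemma 7; the Boolean
basis has no constants, so constant leaves are pruned: a summand / factor whose shadow is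
constant is dropped and the other side alone computes the shadow, `exists_cleanFormula_nnshadow`).

Edge cases are handled by the junk value of `formulaSizeOver`: the shadow of `p` is constant iff
`p = 0` or `coeff 0 p ≠ 0` (`nnshadow_all_true_iff`, `nnshadow_all_false_iff`), and a constant
function has no formula over `{∧₂, ∨₂}`, so `formulaSizeOver monotoneBasis _ = 0`
(`formulaSizeOver_monotoneBasis_eq_zero_of_not_nonconst`).

Main result: `stub_shadowOfArithExpr` — for every `φ : ArithExpr ℝ≥0 ι`,
`formulaSizeOver monotoneBasis (B val(φ)) ≤ E(φ)`.

References: S. Jukna, arXiv:1406.3065, Lemma 7; S. Jukna, *Boolean Function Complexity* (2012),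
§1.2 (formulas over a basis); BCS 1997 (21.19) (`ArithExpr`).
-/

-- Sub = Summit single-conjunct layout: the duplicated namespace component is mandated by the tree.
set_option linter.dupNamespace false

noncomputable section

namespace Summit.ValiantsHypothesis.ValiantsHypothesis.Theorems.ShallowShadowsShadowFormulaTransfer

open Literature.Computability.AlgebraicComplexity Literature.Computability.Complexity
open scoped NNReal

variable {ι : Type}

/-! ### No cancellation over `ℝ≥0` -/

/-- Over `ℝ≥0` sums do not cancel: `supp (p + q) = supp p ∪ supp q`. [folklore] -/
theorem nn_mem_support_add_iff (p q : MvPolynomial ι ℝ≥0) (m : ι →₀ ℕ) :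
    m ∈ (p + q).support ↔ m ∈ p.support ∨ m ∈ q.support := by
  simp only [MvPolynomial.mem_support_iff, MvPolynomial.coeff_add, ne_eq, add_eq_zero, not_and_or]

/-- Over `ℝ≥0` products do not cancel: a monomial of `p` times a monomial of `q` is a monomial of
`p · q`. [folklore] -/
theorem nn_add_mem_support_mul {p q : MvPolynomial ι ℝ≥0} {m₁ m₂ : ι →₀ ℕ}
    (h₁ : m₁ ∈ p.support) (h₂ : m₂ ∈ q.support) : m₁ + m₂ ∈ (p * q).support := by
  classical
  rw [MvPolynomial.mem_support_iff] at h₁ h₂ ⊢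
  rw [MvPolynomial.coeff_mul]
  intro h
  have h0 := (Finset.sum_eq_zero_iff.mp h) (m₁, m₂) (by simp)
  rcases mul_eq_zero.mp h0 with h0 | h0
  · exact h₁ h0
  · exact h₂ h0

/-! ### The shadow under `+`, `·`, and its constant cases -/

/-- **`B (p + q) = B p ∨ B q`** over `ℝ≥0`. [folklore] -/
theorem nnshadow_add_iff (p q : MvPolynomial ι ℝ≥0) (a : ι → Bool) :
    (∃ m ∈ (p + q).support, ∀ i ∈ m.support, a i = true) ↔
      (∃ m ∈ p.support, ∀ i ∈ m.support, a i = true) ∨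
        ∃ m ∈ q.support, ∀ i ∈ m.support, a i = true := by
  simp only [nn_mem_support_add_iff, or_and_right, exists_or]

/-- **`B (p · q) = B p ∧ B q`** over `ℝ≥0`. [folklore] -/
theorem nnshadow_mul_iff (p q : MvPolynomial ι ℝ≥0) (a : ι → Bool) :
    (∃ m ∈ (p * q).support, ∀ i ∈ m.support, a i = true) ↔
      (∃ m ∈ p.support, ∀ i ∈ m.support, a i = true) ∧
        ∃ m ∈ q.support, ∀ i ∈ m.support, a i = true := by
  classical
  constructor
  · rintro ⟨m, hm, hma⟩
    obtain ⟨m₁, hm₁, m₂, hm₂, rfl⟩ := Finset.mem_add.1 (MvPolynomial.support_mul p q hm)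
    refine ⟨⟨m₁, hm₁, fun i hi => hma i ?_⟩, ⟨m₂, hm₂, fun i hi => hma i ?_⟩⟩
    · rw [Finsupp.mem_support_iff] at hi ⊢
      rw [Finsupp.add_apply]
      omega
    · rw [Finsupp.mem_support_iff] at hi ⊢
      rw [Finsupp.add_apply]
      omega
  · rintro ⟨⟨m₁, hm₁, h₁⟩, ⟨m₂, hm₂, h₂⟩⟩
    refine ⟨m₁ + m₂, nn_add_mem_support_mul hm₁ hm₂, fun i hi => ?_⟩
    rcases Finset.mem_union.1 (Finsupp.support_add hi) with hi | hi
    · exact h₁ i hi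
    · exact h₂ i hi

/-- A polynomial with a constant term has the constant shadow `⊤`. [folklore] -/
theorem nnshadow_of_coeff_zero_ne_zero {p : MvPolynomial ι ℝ≥0} (h : p.coeff 0 ≠ 0)
    (a : ι → Bool) : ∃ m ∈ p.support, ∀ i ∈ m.support, a i = true :=
  ⟨0, MvPolynomial.mem_support_iff.2 h, fun i hi => by simp at hi⟩

/-- The shadow is identically `⊤` iff it holds at the all-zeros input iff `coeff 0 p ≠ 0`.
[folklore] -/
theorem nnshadow_all_false_iff (p : MvPolynomial ι ℝ≥0) :
    (∃ m ∈ p.support, ∀ i ∈ m.support, (fun _ : ι => false) i = true) ↔ p.coeff 0 ≠ 0 := by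
  refine ⟨?_, fun h => nnshadow_of_coeff_zero_ne_zero h _⟩
  rintro ⟨m, hm, hma⟩
  have h0 : m = 0 := by
    ext i
    by_contra hi
    exact Bool.false_ne_true (hma i (Finsupp.mem_support_iff.2 hi))
  subst h0
  exact MvPolynomial.mem_support_iff.1 hm

/-- The shadow is identically `⊥` iff it fails at the all-ones input iff `p = 0`. [folklore] -/
theorem nnshadow_all_true_iff (p : MvPolynomial ι ℝ≥0) :
    (∃ m ∈ p.support, ∀ i ∈ m.support, (fun _ : ι => true) i = true) ↔ p ≠ 0 := by
  constructor
  · rintro ⟨m, hm, -⟩ rfl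
    simp at hm
  · intro hp
    obtain ⟨m, hm⟩ := MvPolynomial.support_nonempty.2 hp
    exact ⟨m, hm, fun _ _ => rfl⟩

/-! ### Jukna's Lemma 7: the gate-by-gate monotone formula -/

/-- **Jukna's Lemma 7, clean-formula form** (arXiv:1406.3065, Lemma 7, in the tree's models). If
the shadow of `val(φ)` is non-constant (`val(φ) ≠ 0` and `coeff 0 val(φ) = 0`), then replacing
`+ ↦ ∨₂`, `× ↦ ∧₂` and pruning the summands / factors with constant shadow yields a clean formula
over `{∧₂, ∨₂}` computing the shadow of `val(φ)` with at most `E(φ)` gates. [folklore] -/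
theorem exists_cleanFormula_nnshadow (φ : ArithExpr ℝ≥0 ι) (h0 : φ.eval ≠ 0)
    (hc : φ.eval.coeff 0 = 0) :
    ∃ C : Circuit ι, C.IsOver monotoneBasis ∧
      (C.IsFormula ∧ ∀ m, C.output = .inr m → C.refCount m = 0) ∧
      (∀ a, C.eval a = true ↔ ∃ m ∈ φ.eval.support, ∀ i ∈ m.support, a i = true) ∧
      C.size ≤ φ.size := by
  induction φ with
  | var i =>
    refine ⟨Circuit.input i, Circuit.isOver_input _ i, Circuit.isFormula_input i, fun a => ?_,
      by simp⟩
    rw [Circuit.eval_input, ArithExpr.eval_var, MvPolynomial.support_X]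
    simp only [Finset.mem_singleton, exists_eq_left, Finsupp.support_single _ one_ne_zero,
      forall_eq]
  | const c =>
    exfalso
    rw [ArithExpr.eval_const, MvPolynomial.coeff_zero_C] at hc
    subst hc
    exact h0 (by simp)
  | add φ₁ φ₂ ih₁ ih₂ =>
    rw [ArithExpr.eval_add] at h0 hc
    rw [MvPolynomial.coeff_add, add_eq_zero] at hc
    simp only [ArithExpr.eval_add, ArithExpr.size_add, nnshadow_add_iff]
    by_cases h₁ : φ₁.eval = 0
    · -- `val(φ₁) = 0`: its shadow is `⊥`, the formula of `φ₂` alone computes the shadow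
      have h₂ : φ₂.eval ≠ 0 := fun h₂ => h0 (by rw [h₁, h₂, add_zero])
      obtain ⟨C, hO, hF, hC, hs⟩ := ih₂ h₂ hc.2
      refine ⟨C, hO, hF, fun a => ?_, by omega⟩
      rw [hC a, h₁]
      simp
    by_cases h₂ : φ₂.eval = 0
    · -- `val(φ₂) = 0`: symmetric
      obtain ⟨C, hO, hF, hC, hs⟩ := ih₁ h₁ hc.1
      refine ⟨C, hO, hF, fun a => ?_, by omega⟩
      rw [hC a, h₂]
      simp
    -- both shadows non-constant: `C₁ ∨ C₂`
    obtain ⟨C₁, hO₁, hF₁, hC₁, hs₁⟩ := ih₁ h₁ hc.1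
    obtain ⟨C₂, hO₂, hF₂, hC₂, hs₂⟩ := ih₂ h₂ hc.2
    refine ⟨Circuit.binop (GateFn.or 2).2 C₁ C₂,
      Circuit.isOver_binop Circuit.or_two_mem_monotoneBasis hO₁ hO₂,
      Circuit.isFormula_binop _ hF₁.1 hF₁.2 hF₂.1 hF₂.2, fun a => ?_, ?_⟩
    · rw [Circuit.eval_binop, Circuit.or_two_apply_pair, Bool.or_eq_true, hC₁ a, hC₂ a]
    · rw [Circuit.size_binop]
      omega
  | mul φ₁ φ₂ ih₁ ih₂ =>
    rw [ArithExpr.eval_mul] at h0 hc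
    have h₁ : φ₁.eval ≠ 0 := left_ne_zero_of_mul h0
    have h₂ : φ₂.eval ≠ 0 := right_ne_zero_of_mul h0
    rw [← MvPolynomial.constantCoeff_eq, map_mul, mul_eq_zero, MvPolynomial.constantCoeff_eq]
      at hc
    simp only [ArithExpr.eval_mul, ArithExpr.size_mul, nnshadow_mul_iff]
    by_cases hc₁ : φ₁.eval.coeff 0 = 0
    · by_cases hc₂ : φ₂.eval.coeff 0 = 0
      · -- both shadows non-constant: `C₁ ∧ C₂`
        obtain ⟨C₁, hO₁, hF₁, hC₁, hs₁⟩ := ih₁ h₁ hc₁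
        obtain ⟨C₂, hO₂, hF₂, hC₂, hs₂⟩ := ih₂ h₂ hc₂
        refine ⟨Circuit.binop (GateFn.and 2).2 C₁ C₂,
          Circuit.isOver_binop Circuit.and_two_mem_monotoneBasis hO₁ hO₂,
          Circuit.isFormula_binop _ hF₁.1 hF₁.2 hF₂.1 hF₂.2, fun a => ?_, ?_⟩
        · rw [Circuit.eval_binop, Circuit.and_two_apply_pair, Bool.and_eq_true, hC₁ a, hC₂ a]
        · rw [Circuit.size_binop]
          omega
      · -- `coeff 0 val(φ₂) ≠ 0`: its shadow is `⊤`, the formula of `φ₁` alone computes the shadow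
        obtain ⟨C, hO, hF, hC, hs⟩ := ih₁ h₁ hc₁
        refine ⟨C, hO, hF, fun a => ?_, by omega⟩
        rw [hC a]
        exact (and_iff_left (nnshadow_of_coeff_zero_ne_zero hc₂ a)).symm
    · -- `coeff 0 val(φ₁) ≠ 0`: then `coeff 0 val(φ₂) = 0`, symmetric
      have hc₂ : φ₂.eval.coeff 0 = 0 := hc.resolve_left hc₁
      obtain ⟨C, hO, hF, hC, hs⟩ := ih₂ h₂ hc₂
      refine ⟨C, hO, hF, fun a => ?_, by omega⟩
      rw [hC a]
      exact (and_iff_right (nnshadow_of_coeff_zero_ne_zero hc₁ a)).symm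

/-! ### The stub -/

/-- **Stub `ShadowOfArithExpr` (Jukna's Lemma 7, arXiv:1406.3065, formula form, in the tree's
models).** For every monotone arithmetic formula `φ` over `ℝ≥0` (BCS (21.19)), the monotone formula
complexity of the shadow `a ↦ [∃ m ∈ supp val(φ), supp m ⊆ a]` of `val(φ)` is at most the size
`E(φ)` of `φ`: gate by gate `+ ↦ ∨₂`, `× ↦ ∧₂` (`exists_cleanFormula_nnshadow`) when the shadow is
non-constant, and the junk value `0` of `formulaSizeOver` over the constant-free basis `{∧₂, ∨₂}`
otherwise. [folklore] -/
theorem stub_shadowOfArithExpr :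
    ∀ (ι : Type) [Fintype ι] (φ : ArithExpr ℝ≥0 ι),
      formulaSizeOver monotoneBasis
          (fun a : ι → Bool => decide (∃ m ∈ φ.eval.support, ∀ i ∈ m.support, a i = true)) ≤
        φ.size := by
  intro ι _ φ
  by_cases h : φ.eval ≠ 0 ∧ φ.eval.coeff 0 = 0
  · obtain ⟨C, hO, hF, hC, hs⟩ := exists_cleanFormula_nnshadow φ h.1 h.2
    refine (formulaSizeOver_le_of_computes C hO hF.1 fun a => ?_).trans hs
    rw [Bool.eq_iff_iff, decide_eq_true_iff]
    exact hC a
  · rw [formulaSizeOver_monotoneBasis_eq_zero_of_not_nonconst]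
    · exact Nat.zero_le _
    · rintro ⟨⟨a, ha⟩, ⟨b, hb⟩⟩
      rw [decide_eq_true_iff] at ha
      rw [decide_eq_false_iff_not] at hb
      refine h ⟨?_, ?_⟩
      · rintro h0
        rw [h0] at ha
        simp at ha
      · by_contra hc0
        exact hb (nnshadow_of_coeff_zero_ne_zero hc0 b)

end Summit.ValiantsHypothesis.ValiantsHypothesis.Theorems.ShallowShadowsShadowFormulaTransfer

end
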